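import Mathlib
import HarnessLib
import Summits.PneNP.PneNP.Theorems.CnfIdealGenLengthRankDefectRepresentationsJointCutLemma
import Summits.PneNP.PneNP.Theorems.CnfIdealGenLengthRankDefectRepresentationsAbsoluteMergePair
import Summits.PneNP.PneNP.Theorems.CnfIdealGenLengthRankDefectRepresentationsPolyOfAbsoluteMergeLevels

/-!
# The insertion lemma with an ABSOLUTE constant (crux `RankDefectRepresentations` = stmt-PneNP-18923, line `cell-union-merge`; lead g18)

Tool for the lead stub `stub_absoluteMerge` (AMB) of `Cruxes/RankDefectRepresentations/Lines/cell_union_merge.lean`.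
Let `P : X → K^{d×d}`, `Q : Y → K^{d×d}` be two COMMUTING complete orthogonal systems of idempotents and `E` an idempotent
with `rank [E, P_A] ≤ u` for every union `P_A = ∑_{x∈A} P_x` and `rank [E, Q_B] ≤ v` for every union `Q_B`.  Then `E` is
within rank `16 · (144 u + 8 v)` of an idempotent commuting with every `P_x` and every `Q_y` (`exists_idempotent_commuting_pair`).

Proof: the product system `R_{(x,y)} = P_x Q_y` is a complete orthogonal system of idempotents (`…PolyOfAbsoluteMergeLevels.prod_cells_*`);
by the joint cut lemma (`…JointCutLemma.jointCut`, bench B1 p728169) every union of joint cells has `rank [R_C, E] ≤ 144 u + 8 v`;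
the `|X| = 2` shadow of AMB (`…AbsoluteMergePair.stub_absoluteMergePair`, bench W26 p727869) applied to `E` against `R`
gives the idempotent, and anything commuting with all joint cells commutes with their cylinder sums `P_x`, `Q_y`.

Special case `u = 0` (`exists_idempotent_commuting_pair_of_comm`): an idempotent commuting EXACTLY with `P` and union-nearly
(`≤ v`) with `Q` is within `128 v` of an idempotent commuting with both — the per-step cost of generator insertion is absolute;
what compounds in sequential insertion (memo `Lines/rank-dehn-ladder-g17.md` §4b(iv), `Lines/cell-union-merge-g18.md` §2) is only
the DRIFT `u` (the new generator commutes with the original earlier generators, not with their modifications).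
HONEST FRAMING: a tool in the negative lane of the crux; AMB itself (absolute `λ` for arbitrary `|X|`) stays open; P ≠ NP is
not moved; F-N2 is a FRONTIER formal rung.
-/

set_option linter.dupNamespace false -- `Summit.PneNP.PneNP.…`: summit = sub-problem name (D-0017)

namespace Summit.PneNP.PneNP.Theorems.CnfIdealGenLengthRankDefectRepresentationsInsertion

open Matrix
open Summit.PneNP.PneNP.Theorems.CnfIdealGenLengthRankDefectRepresentationsJointCutLemma (jointCut)
open Summit.PneNP.PneNP.Theorems.CnfIdealGenLengthRankDefectRepresentationsAbsoluteMergePair (stub_absoluteMergePair)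
open Summit.PneNP.PneNP.Theorems.CnfIdealGenLengthRankDefectRepresentationsPolyOfAbsoluteMergeLevels
  (prod_cells_idem prod_cells_orth prod_cells_sum rank_comm_symm)

variable {K : Type} [Field K] {d : ℕ}

/-- Anything commuting with every cell of a family commutes with every finite sum of cells. [folklore] -/
theorem comm_sum_of_comm_cells {ι : Type} (R : ι → Matrix (Fin d) (Fin d) K) (E : Matrix (Fin d) (Fin d) K)
    (h : ∀ i, E * R i = R i * E) (S : Finset ι) : E * (∑ i ∈ S, R i) = (∑ i ∈ S, R i) * E := by
  rw [Finset.mul_sum, Finset.sum_mul]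
  exact Finset.sum_congr rfl fun i _ => h i

/-- **The insertion lemma (absolute constant).**  For two commuting complete orthogonal systems of idempotents `P, Q`
and an idempotent `E` whose commutators with all `P`-unions have rank `≤ u` and with all `Q`-unions rank `≤ v`, there is
an idempotent `E'` commuting with every `P_x` and every `Q_y` with `rank (E − E') ≤ 16 (144 u + 8 v)`.
(Product system + joint cut lemma + the `|X| = 2` absolute merge.) -/
theorem exists_idempotent_commuting_pair {X Y : Type} [Fintype X] [Fintype Y] [DecidableEq X] [DecidableEq Y]
    (P : X → Matrix (Fin d) (Fin d) K) (Q : Y → Matrix (Fin d) (Fin d) K) (E : Matrix (Fin d) (Fin d) K) (u v : ℕ)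
    (hPi : ∀ x, P x * P x = P x) (hPo : ∀ x x', x ≠ x' → P x * P x' = 0) (hPs : ∑ x, P x = 1)
    (hQi : ∀ y, Q y * Q y = Q y) (hQo : ∀ y y', y ≠ y' → Q y * Q y' = 0) (hQs : ∑ y, Q y = 1)
    (hPQ : ∀ x y, P x * Q y = Q y * P x) (hE : E * E = E)
    (hu : ∀ A : Finset X, (E * (∑ x ∈ A, P x) - (∑ x ∈ A, P x) * E).rank ≤ u)
    (hv : ∀ B : Finset Y, (E * (∑ y ∈ B, Q y) - (∑ y ∈ B, Q y) * E).rank ≤ v) :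
    ∃ E' : Matrix (Fin d) (Fin d) K, E' * E' = E' ∧ (∀ x, E' * P x = P x * E') ∧ (∀ y, E' * Q y = Q y * E') ∧
      (E - E').rank ≤ 16 * (144 * u + 8 * v) := by
  -- the product system
  set R : X × Y → Matrix (Fin d) (Fin d) K := fun p => P p.1 * Q p.2 with hR
  have hRi : ∀ p, R p * R p = R p := fun p => prod_cells_idem P Q hPi hQi hPQ p
  have hRo : ∀ p q, p ≠ q → R p * R q = 0 := fun p q hpq => prod_cells_orth P Q hPo hQo hPQ p q hpq
  have hRs : ∑ p, R p = 1 := prod_cells_sum P Q hPs hQs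
  -- joint unions are cheap against `E`
  have hC : ∀ C : Finset (X × Y), (E * (∑ p ∈ C, R p) - (∑ p ∈ C, R p) * E).rank ≤ 144 * u + 8 * v := by
    intro C
    rw [rank_comm_symm]
    exact jointCut P Q E u v hPi hPo hPs hQi hQo hQs hPQ
      (fun A => by rw [rank_comm_symm]; exact hu A) (fun B => by rw [rank_comm_symm]; exact hv B) C
  obtain ⟨E', hE'i, hE'c, hE'r⟩ := stub_absoluteMergePair K d (X × Y) E R (144 * u + 8 * v) hE hRi hRo hRs hC
  refine ⟨E', hE'i, fun x => ?_, fun y => ?_, hE'r⟩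
  · -- `P x` is the cylinder `{x} × Y`
    have hx : P x = ∑ p ∈ ({x} : Finset X) ×ˢ (Finset.univ : Finset Y), R p := by
      rw [Finset.sum_product, Finset.sum_singleton]
      simp only [hR, ← Finset.mul_sum, hQs, Matrix.mul_one]
    rw [hx]
    exact comm_sum_of_comm_cells R E' hE'c _
  · -- `Q y` is the cylinder `X × {y}`
    have hy : Q y = ∑ p ∈ (Finset.univ : Finset X) ×ˢ ({y} : Finset Y), R p := by
      rw [Finset.sum_product]
      simp only [hR, Finset.sum_singleton, ← Finset.sum_mul, hPs, Matrix.one_mul]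
    rw [hy]
    exact comm_sum_of_comm_cells R E' hE'c _

/-- **Insertion with exact commutation on one side** (`u = 0`): an idempotent commuting with every `P_x` and union-nearly
(`≤ v`) with `Q` is within rank `128 v` of an idempotent commuting with every `P_x` and every `Q_y`.  The per-generator step of
sequential insertion therefore costs an ABSOLUTE constant; the known polynomial-in-`|X|` blow-up comes only from the drift of the
earlier generators. -/
theorem exists_idempotent_commuting_pair_of_comm {X Y : Type} [Fintype X] [Fintype Y] [DecidableEq X] [DecidableEq Y]
    (P : X → Matrix (Fin d) (Fin d) K) (Q : Y → Matrix (Fin d) (Fin d) K) (E : Matrix (Fin d) (Fin d) K) (v : ℕ)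
    (hPi : ∀ x, P x * P x = P x) (hPo : ∀ x x', x ≠ x' → P x * P x' = 0) (hPs : ∑ x, P x = 1)
    (hQi : ∀ y, Q y * Q y = Q y) (hQo : ∀ y y', y ≠ y' → Q y * Q y' = 0) (hQs : ∑ y, Q y = 1)
    (hPQ : ∀ x y, P x * Q y = Q y * P x) (hE : E * E = E) (hEP : ∀ x, E * P x = P x * E)
    (hv : ∀ B : Finset Y, (E * (∑ y ∈ B, Q y) - (∑ y ∈ B, Q y) * E).rank ≤ v) :
    ∃ E' : Matrix (Fin d) (Fin d) K, E' * E' = E' ∧ (∀ x, E' * P x = P x * E') ∧ (∀ y, E' * Q y = Q y * E') ∧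
      (E - E').rank ≤ 128 * v := by
  have hu : ∀ A : Finset X, (E * (∑ x ∈ A, P x) - (∑ x ∈ A, P x) * E).rank ≤ 0 := by
    intro A
    rw [comm_sum_of_comm_cells P E hEP A, sub_self, Matrix.rank_zero]
  obtain ⟨E', h1, h2, h3, h4⟩ := exists_idempotent_commuting_pair P Q E 0 v hPi hPo hPs hQi hQo hQs hPQ hE hu hv
  exact ⟨E', h1, h2, h3, h4.trans (by omega)⟩

end Summit.PneNP.PneNP.Theorems.CnfIdealGenLengthRankDefectRepresentationsInsertion
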